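import Summits.QuantumFields.BalabanUV.Beta.D1BFx.KCombineCovColourSrc
import Summits.QuantumFields.BalabanUV.Beta.D1BFx.KCombineCovStripped

/-!
# `BalabanUV.Beta.D1BFx.KCombineCovSrc` — road «BF-x» for binder row D1, slot (K), identity side: **«(A1) v2 WITH SOURCES» STEP 3 —
# THE DICTIONARY STEP AND THE `ℤ⁴` IDENTITY OF THE (R1-L) ORGANISATION WITHOUT THE ONE-SIDED WARD-L LETTERS** — (A1)
# `KCombineCovStripped.hessKer_transfer_road_cov_stripped` with `aₛ aₜ aₛₜ` REMOVED: the failures `E•`, their sandwiches `Z•`, the deflated jets and the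
# source word `σ` are DISPLAYED (named by hypothesis-equations, per torus), the source word's `ℤ⁴` limit `σ∞` is a hypothesis, and the conclusion reads
#   `hessKer G_M 𝒱M 𝒲M μ ν z + (hessKer (Cgh (m+1) a) Lgh Lgh₂ μ ν z + σ∞) = hessKer (NlegRoad m a) 𝒱N 𝒲N μ ν z + 2·hessKer idK1 nFcol nFcolMix μ ν z`

HONEST FRAMING (cell contract, verbatim): «discharging `BetaPertH` makes Bałaban's UV stability UNCONDITIONAL — a real constructive-QFT
result; it is NOT the continuum limit and NOT the Clay problem.»  HONEST DEPENDENCY (verbatim): «continuum YM on T⁴ ⇐ BetaPertH ∧ nine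
spine estimates (0/9 proved); BetaPertH ⇐ (D1) ∧ (D4) ∧ CAP+tail; G-an2-4 gates asym, D1 and NE2/3/4.»  THIS MODULE DISCHARGES NOTHING of
D1 ∕ BetaPertH: [folklore] finite linear algebra + one `Filter` bookkeeping step, composing BY NAME STEP 2 (`KCombineCovColourSrc.hessT_transfer_src_stripped`),
this lineage's (A1) infrastructure (`KCombineCov.hessKer_transfer_road_cov_limits`, `KCombineCovColourTorus` §1∕§3∕§4, `KCombineCovStripped.eventually_l1_add_three_le`,
`KCombineCovLegs`, `KCombineCovTowers`, `KGramCovJets`, `CombFPWordArrays`, `KLimitAxial.hessT_inv_MT_corner`, `TorusGaugeBasis`).  No `def`, no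
`def … : Prop`, nothing cited, 0 sorry.  STILL DISPLAYED: the (A2-M∕N) dictionary letters `hJM•`∕`hJN•`, the kinematic letters `hq•`, the source word's
limit `σ∞` (`hσlim`), `Spr (Ga (m+1) a)`, `r ∈ box 4 (m+1)`, the BiLoc letters — and the Gram-cov tower is read at THE CONVENTION's TIP jets (STEP 4 =
the parametric ∕ midpoint re-reading).  0 binders discharged; (K) NOT closed; NOT D1, NOT BetaPertH, NOT continuum, NOT Clay.

ABSOLUTE RULE (cell, verbatim): «No internally-minted statement may enter as a cited fact. Every hypothesis is either kernel-proved in this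
package or a verbatim quotation of a PUBLISHED theorem with page reference. The manuscript(s) under audit are NOT citable for their own
disputed steps — they are the thing under adjudication; programme-internal (2001/route/tribunal) claims are never citable.»

WHY (owner RULING ρ-g11-10 l.32717 (2)(3); my INTENT «(A1) v2» l.32839).  (A1) stands VACUOUSLY in `aₛ aₜ aₛₜ` (T-d1leaf03g13-WARDL, F-d1leaf03g14-1).
STEP 1 (`SliceTransferSources`) and STEP 2 (`KCombineCovColourSrc`) give the stripped transfer WITHOUT those letters, the failures displayed; this
file runs (A1)'s last two floors on it: (§1) the K-FREE twisted Gram-cov reading at TB4-W's jets and THE CONVENTION's tip gauge jets (the tail of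
`KCombineCovColourTorus.hessT_tgramCov_What0_eq_arr`, which used the `a•` letters ONLY to drop `K`); (§2) the per-torus dictionary step with the SOURCE
WORD `σM := hessT(G_M^; deflated M-jets) − hessT(G_M^; undeflated M-jets)` displayed (the dictionary letters stay on the literal's UNdeflated `kkt k• q•`);
(§3) the towers: the Gram slot `hessT(Φ₀⁻¹; Φ• + Z•)` = tower reading + `σΦ`, `σ := σM + σΦ` per torus with `Tendsto σ atTop (𝓝 σ∞)` DISPLAYED.
CONTENT (all [folklore]): §1 `hessT_tgramB_What0_eq_arr`; §2 **`identity_array_currency_cov_What0_src`**; §3 **`hessKer_transfer_road_cov_src`**;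
§4 `hessT_add_sub` (the source word is polynomial in the sources: `hessT` linear in the mixed jet, bilinear in the first jets).
NOT HERE (honest): the evaluation of `E•` (that is «WARD-L WITH SOURCES», `WardJetsSourcesTorus`), the value ∕ existence of `σ∞`, the parametric ∕
midpoint torus words (STEP 4), the dictionary `hJM•`∕`hJN•` (an2's Q2), colour beyond the strip.
Unit `b2b-balaban-beta-d1-formalise-leaf-03` (gen 14), D1 formalisation swarm LEAF PROVER 03; road owner `b2b-balaban-beta-d1-p2`.
-/

noncomputable section

namespace Summit.QuantumFields.BalabanUV.Beta.D1BFx.KCombineCovSrc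

open Matrix Filter Topology
open scoped BigOperators
open Literature.MathematicalPhysics.QuantumFieldTheory.Balaban1983to89
open Literature.MathematicalPhysics.QuantumFieldTheory.Balaban1983to89.Beta
open Literature.MathematicalPhysics.QuantumFieldTheory.Balaban1983to89.Beta.Composition (kkt)
open B12Sec2to5 (l1 l1_nonneg)
open ExpKernelCalculus (MKer Decays BiLoc hessKer)
open AffineAveraging (box toSite unitVec)
open OneStepResolventKernel (Fib)
open OneStepKernelFamily (KInvStep)
open Summit.QuantumFields.BalabanUV.Beta.TameKernelCalculus (Spr)
open Summit.QuantumFields.BalabanUV.Beta.AxialDressingRooted (coDressKBmAt)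
open Summit.QuantumFields.BalabanUV.Beta.D1BFx.FibredPeriodisation (periodiseF)
open Summit.QuantumFields.BalabanUV.Beta.D1BFx.SortedKernels (blocksHat)
open Summit.QuantumFields.BalabanUV.Beta.D1BFx.SortedPack (sortK)
open Summit.QuantumFields.BalabanUV.Beta.D1BFx.SortedEmbedding (e₁)
open Summit.QuantumFields.BalabanUV.Beta.D1BFx.PeriodicArrays (arr toF)
open Summit.QuantumFields.BalabanUV.Beta.D1BFx.MixedVarPackedHess (hessT)
open Summit.QuantumFields.BalabanUV.Beta.D1BFx.GramWeightJets (gram₀ gram₁)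
open Summit.QuantumFields.BalabanUV.Beta.D1BFx.GramWeightJetsMixed (gramMix)
open Summit.QuantumFields.BalabanUV.Beta.D1BFx.GramWeightColourLift (tj₂ tgram₁ tgramMix)
open Summit.QuantumFields.BalabanUV.Beta.D1BFx.TorusCombKKT (I J CombRows tauT Khat Qhat isUnit_det_MT)
open Summit.QuantumFields.BalabanUV.Beta.D1BFx.TorusGaugeBasis (What0 tauT_mul_What0 Khat_mul_What0 Qhat_mul_What0)
open Summit.QuantumFields.BalabanUV.Beta.D1BFx.TorusGaugeBasisTranspose (Khat_transpose)
open Summit.QuantumFields.BalabanUV.Beta.D1BFx.TorusGaugeBasisMatrix (Nhat)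
open Summit.QuantumFields.BalabanUV.Beta.D1BFx.TorusCoframeJets (Djet Tjet₀ Tjet₁ Tjet₁₁ Ajet₀ Ajet₁ Ajet₁₁)
open Summit.QuantumFields.BalabanUV.Beta.D1BFx.KLimitAxial (hessT_inv_MT_corner)
open Summit.QuantumFields.BalabanUV.Beta.D1BFx.RWeightedLegPack (NlegRoad)
open Summit.QuantumFields.BalabanUV.Beta.D1BFx.GaugeJetLocal (idK1)
open Summit.QuantumFields.BalabanUV.Beta.D1BFx.KGhostLeg (Cgh)
open Summit.QuantumFields.BalabanUV.Beta.D1BFx.TorusGhostWordArrays (Lgh)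
open Summit.QuantumFields.BalabanUV.Beta.D1BFx.TorusGhostPairStencils (Lgh₂)
open Summit.QuantumFields.BalabanUV.Beta.D1BFx.CombFPWordArrays (nFcol hessT_combFP_What0_eq_arr)
open Summit.QuantumFields.BalabanUV.Beta.D1BFx.KLimitGluon (tendsto_hessT_NlegRoad)
open Summit.QuantumFields.BalabanUV.Beta.D1BFx.KCombineCov (hessKer_transfer_road_cov_limits)
open Summit.QuantumFields.BalabanUV.Beta.D1BFx.KCombineCovLegs (det_Tjet₀_mul_What0_ne_zero det_Ajet₀_Nhat_ne_zero det_gram₀_What0_road_ne_zero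
  inv_kkt_gram₀_Tjet_Nhat_eq_blocksHat)
open Summit.QuantumFields.BalabanUV.Beta.D1BFx.KCombineCovTowers (combFPMix_eq_of_lt tendsto_gramCov_tower tendsto_combFP_tower Lsq₁_fst_eq_arr Lsq₁₁_fst_eq_arr)
open Summit.QuantumFields.BalabanUV.Beta.D1BFx.KGramCovJets (hessT_gramCov_B_eq_Gjet hessT_Gjet_eq_Cgh_Lsq)
open Summit.QuantumFields.BalabanUV.Beta.D1BFx.KCombineCovColourTorus (hessT_tgram_eq_gram gram₀_add_of_wardL tj₂_mul_sgn transpose_Ajet₀ transpose_Ajet₁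
  transpose_Ajet₁₁)
open Summit.QuantumFields.BalabanUV.Beta.D1BFx.KCombineCovColourSrc (hessT_transfer_src_stripped)
open Summit.QuantumFields.BalabanUV.Beta.D1BFx.KCombineCovStripped (eventually_l1_add_three_le)

/-! ## §1 The K-free twisted «GRAM-COV» reading at TB4-W's jets and THE CONVENTION's (tip) gauge jets -/

section GramReading

variable (m : ℕ) {a : ℝ} (p : ℕ) [NeZero p] {r : Fin 4 → ℕ}

/-- [folklore] **THE K-FREE TWISTED «GRAM-COV» READING** (`s = (m+1)·p`, `b = (σu, μ)`, `b′ = (σu′, ν)`, `|u−u′|₁ + 3 ≤ s`): with `B₀ = gram₀ T₀ A₀`, TWISTED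
weight jets `B̃ₛ = tgram₁ T₀ Tₛ A₀ Aₛ`, `B̃ₛₜ = tgramMix T A` at `T• = Tjet• N̂ e₁`, `A• = Ajet• N̂`, and THE CONVENTION's (tip) gauge jets `W•`:
`hessT ((gram₀ Ŵ₀ B₀)⁻¹; tgram₁ Ŵ₀ Wₛ B₀ B̃ₛ, tgram₁ Ŵ₀ Wₜ B₀ B̃ₜ, tgramMix …) = hessT ((Cgh (m+1) a)^; (arr Lgh μ u)^, (arr Lgh ν u′)^, (arr Lgh₂ μ u ν u′)^)` — NO Ward
letter at all (the tail of `KCombineCovColourTorus.hessT_tgramCov_What0_eq_arr`, which used `aₛ aₜ aₛₜ` only to drop `K`). -/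
theorem hessT_tgramB_What0_eq_arr (ha : 0 < a) (hr : r ∈ box 4 (m + 1)) (μ ν : Fin 4) (u u' : Fin 4 → ℤ)
    (hs : l1 (u - u') + 3 ≤ (((m + 1) * p : ℕ) : ℝ))
    {Wₛ Wₜ Wₛₜ : Matrix (I 3 (m + 1) p) (CombRows (toSite r) (m + 1) p) ℝ}
    (hWₛ : Wₛ = (Djet ((m + 1) * p) (siteOf 4 ((m + 1) * p) u, μ)).submatrix (e₁ (m + 1) p) id * Nhat r (m + 1) p)
    (hWₜ : Wₜ = (Djet ((m + 1) * p) (siteOf 4 ((m + 1) * p) u', ν)).submatrix (e₁ (m + 1) p) id * Nhat r (m + 1) p)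
    (hWₛₜ : Wₛₜ = if (siteOf 4 ((m + 1) * p) u, μ) = (siteOf 4 ((m + 1) * p) u', ν)
      then (Djet ((m + 1) * p) (siteOf 4 ((m + 1) * p) u, μ)).submatrix (e₁ (m + 1) p) id * Nhat r (m + 1) p else 0)
    {B₀ Bₛ Bₜ Bₛₜ : Matrix (I 3 (m + 1) p) (I 3 (m + 1) p) ℝ}
    (hB₀ : B₀ = gram₀ (Tjet₀ ((m + 1) * p) (Nhat r (m + 1) p) (e₁ (m + 1) p)) (Ajet₀ ((m + 1) * p) (Nhat r (m + 1) p)))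
    (hBₛ : Bₛ = tgram₁ (Tjet₀ ((m + 1) * p) (Nhat r (m + 1) p) (e₁ (m + 1) p))
      (Tjet₁ ((m + 1) * p) (siteOf 4 ((m + 1) * p) u, μ) (Nhat r (m + 1) p) (e₁ (m + 1) p))
      (Ajet₀ ((m + 1) * p) (Nhat r (m + 1) p)) (Ajet₁ ((m + 1) * p) (siteOf 4 ((m + 1) * p) u, μ) (Nhat r (m + 1) p)))
    (hBₜ : Bₜ = tgram₁ (Tjet₀ ((m + 1) * p) (Nhat r (m + 1) p) (e₁ (m + 1) p))
      (Tjet₁ ((m + 1) * p) (siteOf 4 ((m + 1) * p) u', ν) (Nhat r (m + 1) p) (e₁ (m + 1) p))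
      (Ajet₀ ((m + 1) * p) (Nhat r (m + 1) p)) (Ajet₁ ((m + 1) * p) (siteOf 4 ((m + 1) * p) u', ν) (Nhat r (m + 1) p)))
    (hBₛₜ : Bₛₜ = tgramMix (Tjet₀ ((m + 1) * p) (Nhat r (m + 1) p) (e₁ (m + 1) p))
      (Tjet₁ ((m + 1) * p) (siteOf 4 ((m + 1) * p) u, μ) (Nhat r (m + 1) p) (e₁ (m + 1) p))
      (Tjet₁ ((m + 1) * p) (siteOf 4 ((m + 1) * p) u', ν) (Nhat r (m + 1) p) (e₁ (m + 1) p))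
      (Tjet₁₁ ((m + 1) * p) (siteOf 4 ((m + 1) * p) u, μ) (siteOf 4 ((m + 1) * p) u', ν) (Nhat r (m + 1) p) (e₁ (m + 1) p))
      (Ajet₀ ((m + 1) * p) (Nhat r (m + 1) p)) (Ajet₁ ((m + 1) * p) (siteOf 4 ((m + 1) * p) u, μ) (Nhat r (m + 1) p))
      (Ajet₁ ((m + 1) * p) (siteOf 4 ((m + 1) * p) u', ν) (Nhat r (m + 1) p))
      (Ajet₁₁ ((m + 1) * p) (siteOf 4 ((m + 1) * p) u, μ) (siteOf 4 ((m + 1) * p) u', ν) (Nhat r (m + 1) p))) :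
    hessT (gram₀ (What0 r (m + 1) p) B₀)⁻¹
        (tgram₁ (What0 r (m + 1) p) Wₛ B₀ Bₛ) (tgram₁ (What0 r (m + 1) p) Wₜ B₀ Bₜ) (tgramMix (What0 r (m + 1) p) Wₛ Wₜ Wₛₜ B₀ Bₛ Bₜ Bₛₜ)
      = hessT (Matrix.of (periodiseF ((m + 1) * p) (toF (Cgh (m + 1) a))))
          (Matrix.of (periodiseF ((m + 1) * p) (toF (arr ((m + 1) * p) (Lgh μ u)))))
          (Matrix.of (periodiseF ((m + 1) * p) (toF (arr ((m + 1) * p) (Lgh ν u')))))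
          (Matrix.of (periodiseF ((m + 1) * p) (toF (arr ((m + 1) * p) (Lgh₂ μ u ν u'))))) := by
  rw [hB₀, hBₛ, hBₜ, hBₛₜ, hessT_tgram_eq_gram _ _ _ _ _ _ _ _ _ _ _ _ (det_Tjet₀_mul_What0_ne_zero m p ha hr) (det_Ajet₀_Nhat_ne_zero m p ha hr),
    hessT_gramCov_B_eq_Gjet m p ha hr _ _ hWₛ hWₜ hWₛₜ, hessT_Gjet_eq_Cgh_Lsq m p ha hr, Lsq₁_fst_eq_arr, Lsq₁_fst_eq_arr,
    Lsq₁₁_fst_eq_arr _ μ ν u u' hs]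

end GramReading

/-! ## §2 The per-torus dictionary step WITH SOURCES -/

section Dictionary

variable {d n : ℕ} [NeZero n] {r : Fin (d + 1) → ℕ} (p : ℕ) [NeZero p]

/-- [folklore] **THE STRIPPED DICTIONARY STEP WITH SOURCES** (STEP 2's `hessT_transfer_src_stripped` at `K₀ := K̂`, `Q₀ := 𝒬̂`, `W₀ := Ŵ₀`, `τ := τ_T`, re-run
through (A1)'s dictionary floor): PARITY-TYPED jets (`kₛ kₜ Aₛ Aₜ` antisymmetric, `kₛₜ A₀ Aₛₜ` symmetric); NO one-sided letter — the failures `E•`, the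
weight jets `B•`∕`F•`, `P`, `P₀`, the twisted FP-Gram jets `Φ•` and the sandwiches `Z•` are named by hypothesis-equations; the kinematic letters `hq•`;
`det(T₀Ŵ₀)`, `det A₀`, `det Φ₀ ≠ 0`; the N-side DICTIONARY letters (`tj₂ (kₛ+Bₛ) qₛ = AN`, …, N-leg `= NL^`) — the M-side arrays `AM AM′ AM″` are free, tied to the literal's UNdeflated jets by the source-word letter; the
Gram slot `hessT (Φ₀⁻¹; Φₛ + Zₛ, Φₜ + Zₜ, Φₛₜ + Zₛₜ) = bΦ`, the comb-FP slot `= eτ`, AND THE SOURCE WORD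
`σM := hessT (G_M^; kkt d̃ₛ qₛ, kkt d̃ₜ qₜ, kkt d̃ₛₜ qₛₜ·D) − hessT (G_M^; AM, AM′, AM″)` (deflated minus undeflated M-jets).  CONCLUSION:
`hessT (G_M^; AM, AM′, AM″) + σM + bΦ = hessT (NL^; AN, AN′, AN″) + 2·eτ`. -/
theorem identity_array_currency_cov_What0_src (hr : r ∈ box (d + 1) n)
    (kₛ kₜ kₛₜ : Matrix (I d n p) (I d n p) ℝ)
    (T₀ tₛ tₜ tₛₜ : Matrix (CombRows (toSite r) n p) (I d n p) ℝ)
    (A₀ Aₛ Aₜ Aₛₜ : Matrix (CombRows (toSite r) n p) (CombRows (toSite r) n p) ℝ)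
    (wₛ wₜ wₛₜ : Matrix (I d n p) (CombRows (toSite r) n p) ℝ) (qₛ qₜ qₛₜ : Matrix (J d p) (I d n p) ℝ)
    (B₀ Bₛ Bₜ Bₛₜ : Matrix (I d n p) (I d n p) ℝ) (Eₛ Eₜ Eₛₜ Fₛ Fₜ P₀ : Matrix (I d n p) (CombRows (toSite r) n p) ℝ)
    (P Φₛ Φₜ Φₛₜ Zₛ Zₜ Zₛₜ : Matrix (CombRows (toSite r) n p) (CombRows (toSite r) n p) ℝ)
    (hkₛ : kₛᵀ = -kₛ) (hkₜ : kₜᵀ = -kₜ) (hkₛₜ : kₛₜᵀ = kₛₜ)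
    (hA₀ : A₀ᵀ = A₀) (hAₛ : Aₛᵀ = -Aₛ) (hAₜ : Aₜᵀ = -Aₜ) (hAₛₜ : Aₛₜᵀ = Aₛₜ)
    (hqₛ : qₛ * What0 r n p + Qhat (d := d) n p * wₛ = 0) (hqₜ : qₜ * What0 r n p + Qhat (d := d) n p * wₜ = 0)
    (hqₛₜ : qₛₜ * What0 r n p + qₛ * wₜ + qₜ * wₛ + Qhat (d := d) n p * wₛₜ = 0)
    (hTW : (T₀ * What0 r n p).det ≠ 0) (hA : A₀.det ≠ 0) (hΦ : (gram₀ (What0 r n p) (Khat (d := d) n p + gram₀ T₀ A₀)).det ≠ 0)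
    (hB₀ : B₀ = gram₀ T₀ A₀) (hBₛ : Bₛ = tgram₁ T₀ tₛ A₀ Aₛ) (hBₜ : Bₜ = tgram₁ T₀ tₜ A₀ Aₜ) (hBₛₜ : Bₛₜ = tgramMix T₀ tₛ tₜ tₛₜ A₀ Aₛ Aₜ Aₛₜ)
    (hEₛ : Eₛ = kₛ * What0 r n p + Khat (d := d) n p * wₛ) (hEₜ : Eₜ = kₜ * What0 r n p + Khat (d := d) n p * wₜ)
    (hEₛₜ : Eₛₜ = kₛₜ * What0 r n p + kₛ * wₜ + kₜ * wₛ + Khat (d := d) n p * wₛₜ)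
    (hFₛ : Fₛ = Bₛ * What0 r n p + B₀ * wₛ) (hFₜ : Fₜ = Bₜ * What0 r n p + B₀ * wₜ)
    (hP : P = (gram₀ (What0 r n p) B₀)⁻¹) (hP₀ : P₀ = B₀ * What0 r n p * P)
    (hΦₛ : Φₛ = tgram₁ (What0 r n p) wₛ B₀ Bₛ) (hΦₜ : Φₜ = tgram₁ (What0 r n p) wₜ B₀ Bₜ)
    (hΦₛₜ : Φₛₜ = tgramMix (What0 r n p) wₛ wₜ wₛₜ B₀ Bₛ Bₜ Bₛₜ)
    (hZₛ : Zₛ = (What0 r n p)ᵀ * Eₛ) (hZₜ : Zₜ = (What0 r n p)ᵀ * Eₜ) (hZₛₜ : Zₛₜ = (What0 r n p)ᵀ * Eₛₜ - wₛᵀ * Eₜ - wₜᵀ * Eₛ)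
    {NL : MKer (d + 1) (Fib d)} (AM AM' AM'' AN AN' AN'' : Matrix (I d n p ⊕ J d p) (I d n p ⊕ J d p) ℝ) (bΦ eτ σM : ℝ)
    (hLN : (kkt (Khat (d := d) n p + gram₀ T₀ A₀) (Qhat (d := d) n p))⁻¹ = blocksHat p (sortK n NL))
    (hJN : tj₂ (kₛ + Bₛ) qₛ = AN) (hJN' : tj₂ (kₜ + Bₜ) qₜ = AN') (hJN'' : kkt (kₛₜ + Bₛₜ) qₛₜ = AN'')
    (hbΦ : hessT (gram₀ (What0 r n p) (Khat (d := d) n p + B₀))⁻¹ (Φₛ + Zₛ) (Φₜ + Zₜ) (Φₛₜ + Zₛₜ) = bΦ)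
    (heτ : hessT (1 : Matrix (CombRows (toSite r) n p) (CombRows (toSite r) n p) ℝ)
          (tauT (toSite r) n p * wₛ) (tauT (toSite r) n p * wₜ) (tauT (toSite r) n p * wₛₜ) = eτ)
    (hσM : hessT (blocksHat p (sortK n (coDressKBmAt (toSite r) n (KInvStep (d := d) n 0))))
          (kkt (kₛ - (Eₛ * P₀ᵀ - P₀ * Eₛᵀ) + P₀ * Zₛ * P₀ᵀ) qₛ) (kkt (kₜ - (Eₜ * P₀ᵀ - P₀ * Eₜᵀ) + P₀ * Zₜ * P₀ᵀ) qₜ)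
          (kkt (kₛₜ
            - (Eₛₜ * P₀ᵀ + P₀ * Eₛₜᵀ - P₀ * Zₛₜ * P₀ᵀ)
            - (-(Eₛ * P * Fₜᵀ) - Fₜ * P * Eₛᵀ - Eₛ * P * Φₜ * P₀ᵀ + P₀ * Φₜ * P * Eₛᵀ - Fₜ * P * Zₛ * P₀ᵀ + P₀ * Zₛ * P * Fₜᵀ
                + P₀ * Zₛ * P * Φₜ * P₀ᵀ + P₀ * Φₜ * P * Zₛ * P₀ᵀ)
            - (-(Fₛ * P * Eₜᵀ) - Eₜ * P * Fₛᵀ - Fₛ * P * Zₜ * P₀ᵀ + P₀ * Zₜ * P * Fₛᵀ - Eₜ * P * Φₛ * P₀ᵀ + P₀ * Φₛ * P * Eₜᵀ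
                + P₀ * Φₛ * P * Zₜ * P₀ᵀ + P₀ * Zₜ * P * Φₛ * P₀ᵀ)
            - (-(Eₛ * P * Eₜᵀ) - Eₜ * P * Eₛᵀ - Eₛ * P * Zₜ * P₀ᵀ + P₀ * Zₜ * P * Eₛᵀ - Eₜ * P * Zₛ * P₀ᵀ + P₀ * Zₛ * P * Eₜᵀ
                + P₀ * Zₛ * P * Zₜ * P₀ᵀ + P₀ * Zₜ * P * Zₛ * P₀ᵀ)) qₛₜ
            * Matrix.fromBlocks (1 : Matrix (I d n p) (I d n p) ℝ) 0 0 (-1 : Matrix (J d p) (J d p) ℝ))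
        - hessT (blocksHat p (sortK n (coDressKBmAt (toSite r) n (KInvStep (d := d) n 0)))) AM AM' AM'' = σM) :
    hessT (blocksHat p (sortK n (coDressKBmAt (toSite r) n (KInvStep (d := d) n 0)))) AM AM' AM'' + σM + bΦ
      = hessT (blocksHat p (sortK n NL)) AN AN' AN'' + 2 * eτ := by
  have hτ1 : tauT (toSite r) n p * What0 r n p = 1 := tauT_mul_What0 r n p
  have hτ : (tauT (toSite r) n p * What0 r n p).det ≠ 0 := by rw [hτ1, Matrix.det_one]; exact one_ne_zero
  have hLN' : (kkt (Khat (d := d) n p + B₀) (Qhat (d := d) n p))⁻¹ = blocksHat p (sortK n NL) := by rw [hB₀]; exact hLN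
  have h := hessT_transfer_src_stripped (Khat (d := d) n p) kₛ kₜ kₛₜ T₀ tₛ tₜ tₛₜ A₀ Aₛ Aₜ Aₛₜ (What0 r n p) wₛ wₜ wₛₜ
    (Qhat (d := d) n p) qₛ qₜ qₛₜ (tauT (toSite r) n p) B₀ Bₛ Bₜ Bₛₜ Eₛ Eₜ Eₛₜ Fₛ Fₜ P₀ P Φₛ Φₜ Φₛₜ Zₛ Zₜ Zₛₜ
    (Khat_transpose n p) hkₛ hkₜ hkₛₜ hA₀ hAₛ hAₜ hAₛₜ (Khat_mul_What0 r n p hr) (Qhat_mul_What0 r n p hr) hqₛ hqₜ hqₛₜ hTW hA hΦ hτ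
    (isUnit_det_MT (d := d) hr p).ne_zero hB₀ hBₛ hBₜ hBₛₜ hEₛ hEₜ hEₛₜ hFₛ hFₜ hP hP₀ hΦₛ hΦₜ hΦₛₜ hZₛ hZₜ hZₛₜ
  rw [hessT_inv_MT_corner hr p, tj₂_mul_sgn, tj₂_mul_sgn, hLN', hJN, hJN', hJN'', hbΦ, hτ1, inv_one, heτ] at h
  linarith [hσM]

end Dictionary

/-! ## §3 The `ℤ⁴` identity with sources -/

section Combine

variable (m : ℕ) {a : ℝ} {r : Fin 4 → ℕ}

/-- [folklore] **«(A1) v2 WITH SOURCES» — THE `ℤ⁴` IDENTITY OF THE (R1-L) ORGANISATION WITHOUT THE ONE-SIDED WARD-L LETTERS.**  (A1)'s data VERBATIM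
(co-frame data pinned to TB4-W's jets, gauge jets pinned to THE CONVENTION, the literal's parity-typed jets `k• q•`, the kinematic letters `hq•`, the (A2-M∕N)
dictionary, `Spr (Ga (m+1) a)`, `r ∈ box 4 (m+1)`, the BiLoc letters) EXCEPT that `aₛ aₜ aₛₜ` are GONE; in their place, PER TORUS and named by
hypothesis-equations: the twisted weight jets `B•`, the failures `Eₛ k = kₛ k·Ŵ₀ + K̂·Wₛ k`, `Eₜ`, `Eₛₜ`, `F•`, `P`, `P₀`, the twisted FP-Gram jets `Φ•`, the
sandwiches `Z•`, and the SOURCE WORD `σ k := σM k + (hessT (Φ₀⁻¹; Φ• + Z•) − hessT (Φ₀⁻¹; Φ•))` (`σM` = deflated minus undeflated M-functional, `hσM`)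
with its `ℤ⁴` limit DISPLAYED (`hσlim : Tendsto σ atTop (𝓝 σ∞)`).  CONCLUSION:
`hessKer G_M 𝒱M 𝒲M μ ν z + (hessKer (Cgh (m+1) a) Lgh Lgh₂ μ ν z + σ∞) = hessKer (NlegRoad m a) 𝒱N 𝒲N μ ν z + 2·hessKer idK1 nFcol nFcolMix μ ν z`.
(A1) `hessKer_transfer_road_cov_stripped` is the case `E• = 0`, `σ = 0`. -/
theorem hessKer_transfer_road_cov_src (ha : 0 < a) (hGa : Spr (GluonLeg.Ga (m + 1) a)) (hr : r ∈ box (3 + 1) (m + 1))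
    (𝒱M : Fin 4 → (Fin 4 → ℤ) → MKer 4 (Fib 3)) (𝒲M : Fin 4 → (Fin 4 → ℤ) → Fin 4 → (Fin 4 → ℤ) → MKer 4 (Fib 3))
    (𝒱N : Fin 4 → (Fin 4 → ℤ) → MKer 4 (Fib 3)) (𝒲N : Fin 4 → (Fin 4 → ℤ) → Fin 4 → (Fin 4 → ℤ) → MKer 4 (Fib 3))
    (μ ν : Fin 4) (z : Fin 4 → ℤ)
    {PM PM' QM QM' PN PN' QN QN' : Fin 4 → ℤ} {CvM CvM' CM δM CvN CvN' CN δN : ℝ}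
    (hVM : BiLoc (𝒱M μ 0) PM PM' CvM δM) (hVM' : BiLoc (𝒱M ν z) QM' QM CvM' δM) (hWM : BiLoc (𝒲M μ 0 ν z) PM QM CM δM) (hδM : 0 < δM)
    (hVN : BiLoc (𝒱N μ 0) PN PN' CvN δN) (hVN' : BiLoc (𝒱N ν z) QN' QN CvN' δN) (hWN : BiLoc (𝒲N μ 0 ν z) PN QN CN δN) (hδN : 0 < δN)
    {p : ℕ → ℕ} [∀ k, NeZero (p k)] (hp : Tendsto p atTop atTop)
    -- co-frame data pinned to TB4-W's jets
    (T₀ Tₛ Tₜ Tₛₜ : ∀ k, Matrix (CombRows (toSite r) (m + 1) (p k)) (I 3 (m + 1) (p k)) ℝ)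
    (A₀ Aₛ Aₜ Aₛₜ : ∀ k, Matrix (CombRows (toSite r) (m + 1) (p k)) (CombRows (toSite r) (m + 1) (p k)) ℝ)
    (hT₀ : ∀ k, T₀ k = Tjet₀ ((m + 1) * p k) (Nhat r (m + 1) (p k)) (e₁ (m + 1) (p k)))
    (hTₛ : ∀ k, Tₛ k = Tjet₁ ((m + 1) * p k) (siteOf 4 ((m + 1) * p k) 0, μ) (Nhat r (m + 1) (p k)) (e₁ (m + 1) (p k)))
    (hTₜ : ∀ k, Tₜ k = Tjet₁ ((m + 1) * p k) (siteOf 4 ((m + 1) * p k) z, ν) (Nhat r (m + 1) (p k)) (e₁ (m + 1) (p k)))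
    (hTₛₜ : ∀ k, Tₛₜ k = Tjet₁₁ ((m + 1) * p k) (siteOf 4 ((m + 1) * p k) 0, μ) (siteOf 4 ((m + 1) * p k) z, ν)
      (Nhat r (m + 1) (p k)) (e₁ (m + 1) (p k)))
    (hA₀ : ∀ k, A₀ k = Ajet₀ ((m + 1) * p k) (Nhat r (m + 1) (p k)))
    (hAₛ : ∀ k, Aₛ k = Ajet₁ ((m + 1) * p k) (siteOf 4 ((m + 1) * p k) 0, μ) (Nhat r (m + 1) (p k)))
    (hAₜ : ∀ k, Aₜ k = Ajet₁ ((m + 1) * p k) (siteOf 4 ((m + 1) * p k) z, ν) (Nhat r (m + 1) (p k)))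
    (hAₛₜ : ∀ k, Aₛₜ k = Ajet₁₁ ((m + 1) * p k) (siteOf 4 ((m + 1) * p k) 0, μ) (siteOf 4 ((m + 1) * p k) z, ν) (Nhat r (m + 1) (p k)))
    -- gauge jets pinned to THE CONVENTION
    (Wₛ Wₜ Wₛₜ : ∀ k, Matrix (I 3 (m + 1) (p k)) (CombRows (toSite r) (m + 1) (p k)) ℝ)
    (hWₛ : ∀ k, Wₛ k = (Djet ((m + 1) * p k) (siteOf 4 ((m + 1) * p k) 0, μ)).submatrix (e₁ (m + 1) (p k)) id * Nhat r (m + 1) (p k))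
    (hWₜ : ∀ k, Wₜ k = (Djet ((m + 1) * p k) (siteOf 4 ((m + 1) * p k) z, ν)).submatrix (e₁ (m + 1) (p k)) id * Nhat r (m + 1) (p k))
    (hWₛₜ : ∀ k, Wₛₜ k = if (siteOf 4 ((m + 1) * p k) 0, μ) = (siteOf 4 ((m + 1) * p k) z, ν)
      then (Djet ((m + 1) * p k) (siteOf 4 ((m + 1) * p k) 0, μ)).submatrix (e₁ (m + 1) (p k)) id * Nhat r (m + 1) (p k) else 0)
    -- the literal's parity-typed jets and the kinematic letters
    (kₛ kₜ kₛₜ : ∀ k, Matrix (I 3 (m + 1) (p k)) (I 3 (m + 1) (p k)) ℝ) (qₛ qₜ qₛₜ : ∀ k, Matrix (J 3 (p k)) (I 3 (m + 1) (p k)) ℝ)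
    (hkₛ : ∀ k, (kₛ k)ᵀ = -kₛ k) (hkₜ : ∀ k, (kₜ k)ᵀ = -kₜ k) (hkₛₜ : ∀ k, (kₛₜ k)ᵀ = kₛₜ k)
    (bₛ : ∀ k, qₛ k * What0 r (m + 1) (p k) + Qhat (d := 3) (m + 1) (p k) * Wₛ k = 0)
    (bₜ : ∀ k, qₜ k * What0 r (m + 1) (p k) + Qhat (d := 3) (m + 1) (p k) * Wₜ k = 0)
    (bₛₜ : ∀ k, qₛₜ k * What0 r (m + 1) (p k) + qₛ k * Wₜ k + qₜ k * Wₛ k + Qhat (d := 3) (m + 1) (p k) * Wₛₜ k = 0)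
    -- the source letters, per torus (NO Ward letter)
    (B₀ Bₛ Bₜ Bₛₜ : ∀ k, Matrix (I 3 (m + 1) (p k)) (I 3 (m + 1) (p k)) ℝ)
    (Eₛ Eₜ Eₛₜ Fₛ Fₜ P₀ : ∀ k, Matrix (I 3 (m + 1) (p k)) (CombRows (toSite r) (m + 1) (p k)) ℝ)
    (P Φₛ Φₜ Φₛₜ Zₛ Zₜ Zₛₜ : ∀ k, Matrix (CombRows (toSite r) (m + 1) (p k)) (CombRows (toSite r) (m + 1) (p k)) ℝ)
    (hB₀ : ∀ k, B₀ k = gram₀ (T₀ k) (A₀ k)) (hBₛ : ∀ k, Bₛ k = tgram₁ (T₀ k) (Tₛ k) (A₀ k) (Aₛ k))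
    (hBₜ : ∀ k, Bₜ k = tgram₁ (T₀ k) (Tₜ k) (A₀ k) (Aₜ k)) (hBₛₜ : ∀ k, Bₛₜ k = tgramMix (T₀ k) (Tₛ k) (Tₜ k) (Tₛₜ k) (A₀ k) (Aₛ k) (Aₜ k) (Aₛₜ k))
    (hEₛ : ∀ k, Eₛ k = kₛ k * What0 r (m + 1) (p k) + Khat (d := 3) (m + 1) (p k) * Wₛ k)
    (hEₜ : ∀ k, Eₜ k = kₜ k * What0 r (m + 1) (p k) + Khat (d := 3) (m + 1) (p k) * Wₜ k)
    (hEₛₜ : ∀ k, Eₛₜ k = kₛₜ k * What0 r (m + 1) (p k) + kₛ k * Wₜ k + kₜ k * Wₛ k + Khat (d := 3) (m + 1) (p k) * Wₛₜ k)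
    (hFₛ : ∀ k, Fₛ k = Bₛ k * What0 r (m + 1) (p k) + B₀ k * Wₛ k) (hFₜ : ∀ k, Fₜ k = Bₜ k * What0 r (m + 1) (p k) + B₀ k * Wₜ k)
    (hP : ∀ k, P k = (gram₀ (What0 r (m + 1) (p k)) (B₀ k))⁻¹) (hP₀ : ∀ k, P₀ k = B₀ k * What0 r (m + 1) (p k) * P k)
    (hΦₛ : ∀ k, Φₛ k = tgram₁ (What0 r (m + 1) (p k)) (Wₛ k) (B₀ k) (Bₛ k))
    (hΦₜ : ∀ k, Φₜ k = tgram₁ (What0 r (m + 1) (p k)) (Wₜ k) (B₀ k) (Bₜ k))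
    (hΦₛₜ : ∀ k, Φₛₜ k = tgramMix (What0 r (m + 1) (p k)) (Wₛ k) (Wₜ k) (Wₛₜ k) (B₀ k) (Bₛ k) (Bₜ k) (Bₛₜ k))
    (hZₛ : ∀ k, Zₛ k = (What0 r (m + 1) (p k))ᵀ * Eₛ k) (hZₜ : ∀ k, Zₜ k = (What0 r (m + 1) (p k))ᵀ * Eₜ k)
    (hZₛₜ : ∀ k, Zₛₜ k = (What0 r (m + 1) (p k))ᵀ * Eₛₜ k - (Wₛ k)ᵀ * Eₜ k - (Wₜ k)ᵀ * Eₛ k)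
    -- the source word and its displayed limit
    (σ : ℕ → ℝ) (σlim : ℝ)
    (hσ : ∀ k, σ k
      = (hessT (blocksHat (p k) (sortK (m + 1) (coDressKBmAt (toSite r) (m + 1) (KInvStep (d := 3) (m + 1) 0))))
            (kkt (kₛ k - (Eₛ k * (P₀ k)ᵀ - P₀ k * (Eₛ k)ᵀ) + P₀ k * Zₛ k * (P₀ k)ᵀ) (qₛ k))
            (kkt (kₜ k - (Eₜ k * (P₀ k)ᵀ - P₀ k * (Eₜ k)ᵀ) + P₀ k * Zₜ k * (P₀ k)ᵀ) (qₜ k))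
            (kkt (kₛₜ k
              - (Eₛₜ k * (P₀ k)ᵀ + P₀ k * (Eₛₜ k)ᵀ - P₀ k * Zₛₜ k * (P₀ k)ᵀ)
              - (-(Eₛ k * P k * (Fₜ k)ᵀ) - Fₜ k * P k * (Eₛ k)ᵀ - Eₛ k * P k * Φₜ k * (P₀ k)ᵀ + P₀ k * Φₜ k * P k * (Eₛ k)ᵀ
                  - Fₜ k * P k * Zₛ k * (P₀ k)ᵀ + P₀ k * Zₛ k * P k * (Fₜ k)ᵀ + P₀ k * Zₛ k * P k * Φₜ k * (P₀ k)ᵀ + P₀ k * Φₜ k * P k * Zₛ k * (P₀ k)ᵀ)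
              - (-(Fₛ k * P k * (Eₜ k)ᵀ) - Eₜ k * P k * (Fₛ k)ᵀ - Fₛ k * P k * Zₜ k * (P₀ k)ᵀ + P₀ k * Zₜ k * P k * (Fₛ k)ᵀ
                  - Eₜ k * P k * Φₛ k * (P₀ k)ᵀ + P₀ k * Φₛ k * P k * (Eₜ k)ᵀ + P₀ k * Φₛ k * P k * Zₜ k * (P₀ k)ᵀ + P₀ k * Zₜ k * P k * Φₛ k * (P₀ k)ᵀ)
              - (-(Eₛ k * P k * (Eₜ k)ᵀ) - Eₜ k * P k * (Eₛ k)ᵀ - Eₛ k * P k * Zₜ k * (P₀ k)ᵀ + P₀ k * Zₜ k * P k * (Eₛ k)ᵀ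
                  - Eₜ k * P k * Zₛ k * (P₀ k)ᵀ + P₀ k * Zₛ k * P k * (Eₜ k)ᵀ + P₀ k * Zₛ k * P k * Zₜ k * (P₀ k)ᵀ + P₀ k * Zₜ k * P k * Zₛ k * (P₀ k)ᵀ))
              (qₛₜ k) * Matrix.fromBlocks (1 : Matrix (I 3 (m + 1) (p k)) (I 3 (m + 1) (p k)) ℝ) 0 0 (-1 : Matrix (J 3 (p k)) (J 3 (p k)) ℝ))
          - hessT (blocksHat (p k) (sortK (m + 1) (coDressKBmAt (toSite r) (m + 1) (KInvStep (d := 3) (m + 1) 0))))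
            (kkt (kₛ k) (qₛ k)) (kkt (kₜ k) (qₜ k))
            (kkt (kₛₜ k) (qₛₜ k) * Matrix.fromBlocks (1 : Matrix (I 3 (m + 1) (p k)) (I 3 (m + 1) (p k)) ℝ) 0 0 (-1 : Matrix (J 3 (p k)) (J 3 (p k)) ℝ)))
        + (hessT (gram₀ (What0 r (m + 1) (p k)) (Khat (d := 3) (m + 1) (p k) + B₀ k))⁻¹ (Φₛ k + Zₛ k) (Φₜ k + Zₜ k) (Φₛₜ k + Zₛₜ k)
          - hessT (gram₀ (What0 r (m + 1) (p k)) (B₀ k))⁻¹ (Φₛ k) (Φₜ k) (Φₛₜ k)))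
    (hσlim : Tendsto σ atTop (𝓝 σlim))
    -- the (A2-M∕N) dictionary
    (hJM : ∀ k, kkt (kₛ k) (qₛ k) = blocksHat (p k) (sortK (m + 1) (arr ((m + 1) * p k) (𝒱M μ 0))))
    (hJM' : ∀ k, kkt (kₜ k) (qₜ k) = blocksHat (p k) (sortK (m + 1) (arr ((m + 1) * p k) (𝒱M ν z))))
    (hJM'' : ∀ k, kkt (kₛₜ k) (qₛₜ k) * Matrix.fromBlocks (1 : Matrix (I 3 (m + 1) (p k)) (I 3 (m + 1) (p k)) ℝ) 0 0
        (-1 : Matrix (J 3 (p k)) (J 3 (p k)) ℝ) = blocksHat (p k) (sortK (m + 1) (arr ((m + 1) * p k) (𝒲M μ 0 ν z))))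
    (hJN : ∀ k, tj₂ (kₛ k + Bₛ k) (qₛ k) = blocksHat (p k) (sortK (m + 1) (arr ((m + 1) * p k) (𝒱N μ 0))))
    (hJN' : ∀ k, tj₂ (kₜ k + Bₜ k) (qₜ k) = blocksHat (p k) (sortK (m + 1) (arr ((m + 1) * p k) (𝒱N ν z))))
    (hJN'' : ∀ k, kkt (kₛₜ k + Bₛₜ k) (qₛₜ k) = blocksHat (p k) (sortK (m + 1) (arr ((m + 1) * p k) (𝒲N μ 0 ν z)))) :
    hessKer (coDressKBmAt (toSite r) (m + 1) (KInvStep (d := 3) (m + 1) 0)) 𝒱M 𝒲M μ ν z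
        + (hessKer (Cgh (m + 1) a) (fun κ v => Lgh κ v) (fun κ v l v' => Lgh₂ κ v l v') μ ν z + σlim)
      = hessKer (NlegRoad m a) 𝒱N 𝒲N μ ν z
        + 2 * hessKer idK1 (fun κ v => nFcol r (m + 1) κ v) (fun κ v l v' => if v = v' ∧ κ = l then nFcol r (m + 1) κ v else 0) μ ν z := by
  refine hessKer_transfer_road_cov_limits (d := 3) hr 𝒱M 𝒲M μ ν z hVM hVM' hWM hδM hp
    ((tendsto_gramCov_tower m ha μ ν z hp).add hσlim) (tendsto_hessT_NlegRoad m hGa 𝒱N 𝒲N μ ν z hVN hVN' hWN hδN hp)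
    (tendsto_combFP_tower m hr μ ν z hp) ?_
  filter_upwards [eventually_l1_add_three_le m z hp] with k hk
  have hlt : l1 (0 - z) < (((m + 1) * p k : ℕ) : ℝ) := by linarith
  -- the TB4-W data letters on this torus, by name after un-pinning
  have hA₀s : (A₀ k)ᵀ = A₀ k := by rw [hA₀ k]; exact transpose_Ajet₀ _ _
  have hAₛa : (Aₛ k)ᵀ = -Aₛ k := by rw [hAₛ k]; exact transpose_Ajet₁ _ _ _
  have hAₜa : (Aₜ k)ᵀ = -Aₜ k := by rw [hAₜ k]; exact transpose_Ajet₁ _ _ _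
  have hAₛₜs : (Aₛₜ k)ᵀ = Aₛₜ k := by rw [hAₛₜ k]; exact transpose_Ajet₁₁ _ _ _ _
  have hTW : (T₀ k * What0 r (m + 1) (p k)).det ≠ 0 := by rw [hT₀ k]; exact det_Tjet₀_mul_What0_ne_zero m (p k) ha hr
  have hA : (A₀ k).det ≠ 0 := by rw [hA₀ k]; exact det_Ajet₀_Nhat_ne_zero m (p k) ha hr
  have hΦ : (gram₀ (What0 r (m + 1) (p k)) (Khat (d := 3) (m + 1) (p k) + gram₀ (T₀ k) (A₀ k))).det ≠ 0 := by
    rw [hT₀ k, hA₀ k]; exact det_gram₀_What0_road_ne_zero m (p k) ha hr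
  have hLN : (kkt (Khat (d := 3) (m + 1) (p k) + gram₀ (T₀ k) (A₀ k)) (Qhat (d := 3) (m + 1) (p k)))⁻¹
      = blocksHat (p k) (sortK (m + 1) (NlegRoad m a)) := by
    rw [hT₀ k, hA₀ k]; exact inv_kkt_gram₀_Tjet_Nhat_eq_blocksHat m (p k) ha hGa hr
  -- the K-free Gram-cov tower slot on this torus
  have hK₀B₀ : gram₀ (What0 r (m + 1) (p k)) (Khat (d := 3) (m + 1) (p k) + B₀ k) = gram₀ (What0 r (m + 1) (p k)) (B₀ k) :=
    gram₀_add_of_wardL (Khat_mul_What0 r (m + 1) (p k) hr)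
  have hB₀' : B₀ k = gram₀ (Tjet₀ ((m + 1) * p k) (Nhat r (m + 1) (p k)) (e₁ (m + 1) (p k))) (Ajet₀ ((m + 1) * p k) (Nhat r (m + 1) (p k))) := by
    rw [hB₀ k, hT₀ k, hA₀ k]
  have hBₛ' : Bₛ k = tgram₁ (Tjet₀ ((m + 1) * p k) (Nhat r (m + 1) (p k)) (e₁ (m + 1) (p k)))
      (Tjet₁ ((m + 1) * p k) (siteOf 4 ((m + 1) * p k) 0, μ) (Nhat r (m + 1) (p k)) (e₁ (m + 1) (p k)))
      (Ajet₀ ((m + 1) * p k) (Nhat r (m + 1) (p k))) (Ajet₁ ((m + 1) * p k) (siteOf 4 ((m + 1) * p k) 0, μ) (Nhat r (m + 1) (p k))) := by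
    rw [hBₛ k, hT₀ k, hTₛ k, hA₀ k, hAₛ k]
  have hBₜ' : Bₜ k = tgram₁ (Tjet₀ ((m + 1) * p k) (Nhat r (m + 1) (p k)) (e₁ (m + 1) (p k)))
      (Tjet₁ ((m + 1) * p k) (siteOf 4 ((m + 1) * p k) z, ν) (Nhat r (m + 1) (p k)) (e₁ (m + 1) (p k)))
      (Ajet₀ ((m + 1) * p k) (Nhat r (m + 1) (p k))) (Ajet₁ ((m + 1) * p k) (siteOf 4 ((m + 1) * p k) z, ν) (Nhat r (m + 1) (p k))) := by
    rw [hBₜ k, hT₀ k, hTₜ k, hA₀ k, hAₜ k]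
  have hBₛₜ' : Bₛₜ k = tgramMix (Tjet₀ ((m + 1) * p k) (Nhat r (m + 1) (p k)) (e₁ (m + 1) (p k)))
      (Tjet₁ ((m + 1) * p k) (siteOf 4 ((m + 1) * p k) 0, μ) (Nhat r (m + 1) (p k)) (e₁ (m + 1) (p k)))
      (Tjet₁ ((m + 1) * p k) (siteOf 4 ((m + 1) * p k) z, ν) (Nhat r (m + 1) (p k)) (e₁ (m + 1) (p k)))
      (Tjet₁₁ ((m + 1) * p k) (siteOf 4 ((m + 1) * p k) 0, μ) (siteOf 4 ((m + 1) * p k) z, ν) (Nhat r (m + 1) (p k)) (e₁ (m + 1) (p k)))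
      (Ajet₀ ((m + 1) * p k) (Nhat r (m + 1) (p k))) (Ajet₁ ((m + 1) * p k) (siteOf 4 ((m + 1) * p k) 0, μ) (Nhat r (m + 1) (p k)))
      (Ajet₁ ((m + 1) * p k) (siteOf 4 ((m + 1) * p k) z, ν) (Nhat r (m + 1) (p k)))
      (Ajet₁₁ ((m + 1) * p k) (siteOf 4 ((m + 1) * p k) 0, μ) (siteOf 4 ((m + 1) * p k) z, ν) (Nhat r (m + 1) (p k))) := by
    rw [hBₛₜ k, hT₀ k, hTₛ k, hTₜ k, hTₛₜ k, hA₀ k, hAₛ k, hAₜ k, hAₛₜ k]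
  have hbΦ := hessT_tgramB_What0_eq_arr m (p k) ha hr μ ν 0 z hk (hWₛ k) (hWₜ k) (hWₛₜ k) hB₀' hBₛ' hBₜ' hBₛₜ'
  have heτ := hessT_combFP_What0_eq_arr (m := m) (p := p k) hr μ ν 0 z (hWₛ k) (hWₜ k) (hWₛₜ k)
  rw [combFPMix_eq_of_lt m ((m + 1) * p k) μ ν 0 z hlt] at heτ
  -- the dictionary step with sources on this torus
  have hid := identity_array_currency_cov_What0_src (d := 3) (p k) hr (kₛ k) (kₜ k) (kₛₜ k) (T₀ k) (Tₛ k) (Tₜ k) (Tₛₜ k)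
    (A₀ k) (Aₛ k) (Aₜ k) (Aₛₜ k) (Wₛ k) (Wₜ k) (Wₛₜ k) (qₛ k) (qₜ k) (qₛₜ k) (B₀ k) (Bₛ k) (Bₜ k) (Bₛₜ k)
    (Eₛ k) (Eₜ k) (Eₛₜ k) (Fₛ k) (Fₜ k) (P₀ k) (P k) (Φₛ k) (Φₜ k) (Φₛₜ k) (Zₛ k) (Zₜ k) (Zₛₜ k)
    (hkₛ k) (hkₜ k) (hkₛₜ k) hA₀s hAₛa hAₜa hAₛₜs (bₛ k) (bₜ k) (bₛₜ k) hTW hA hΦ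
    (hB₀ k) (hBₛ k) (hBₜ k) (hBₛₜ k) (hEₛ k) (hEₜ k) (hEₛₜ k) (hFₛ k) (hFₜ k) (hP k) (hP₀ k) (hΦₛ k) (hΦₜ k) (hΦₛₜ k) (hZₛ k) (hZₜ k) (hZₛₜ k)
    (kkt (kₛ k) (qₛ k)) (kkt (kₜ k) (qₜ k))
    (kkt (kₛₜ k) (qₛₜ k) * Matrix.fromBlocks (1 : Matrix (I 3 (m + 1) (p k)) (I 3 (m + 1) (p k)) ℝ) 0 0 (-1 : Matrix (J 3 (p k)) (J 3 (p k)) ℝ))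
    _ _ _ _ _ _ hLN (hJN k) (hJN' k) (hJN'' k) rfl heτ rfl
  have hσk := hσ k
  rw [hK₀B₀] at hid hσk
  rw [hJM k, hJM' k, hJM'' k] at hid hσk
  rw [← hΦₛ k, ← hΦₜ k, ← hΦₛₜ k] at hbΦ
  linarith [hid, hσk, hbΦ]

end Combine

/-! ## §4 The source word is polynomial in the sources -/

section SourceWord

variable {ι : Type*} [Fintype ι]

/-- [folklore] **`hessT` IS LINEAR IN THE MIXED JET AND BILINEAR IN THE FIRST JETS**: for any leg `L`,
`hessT L (V+S) (V′+S′) (W+S″) − hessT L V V′ W = ½·(tr(L·S″) − tr(L·S·(L·V′)) − tr(L·V·(L·S′)) − tr(L·S·(L·S′)))` — the shape of the two halves of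
the source word `σ` of `hessKer_transfer_road_cov_src` (M-side: `S• =` the deflation words; Gram side: `S• = Z•`). -/
theorem hessT_add_sub (L V V' W S S' S'' : Matrix ι ι ℝ) :
    hessT L (V + S) (V' + S') (W + S'') - hessT L V V' W
      = (1 / 2) * ((L * S'').trace - (L * S * (L * V')).trace - (L * V * (L * S')).trace - (L * S * (L * S')).trace) := by
  rw [hessT, hessT]
  simp only [Matrix.mul_add, Matrix.add_mul, Matrix.trace_add]
  ring

end SourceWord

end Summit.QuantumFields.BalabanUV.Beta.D1BFx.KCombineCovSrc

end
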